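import Mathlib.LinearAlgebra.Dimension.Constructions
import Mathlib.LinearAlgebra.Dimension.Finite
import Mathlib.Data.ZMod.Basic
import Mathlib.Data.ENat.Lattice
import Literature.Computability.MetaComplexity.ResLin
import HarnessLib

/-!
# Complexity meta: rank of a linear clause and width (rank) of a Res(⊕) derivation

Companion to `Literature.Computability.MetaComplexity.ResLin` (the proof system Res(⊕) of
Itsykson–Sokolov with semantic weakening). The standard "width" measure of resolution over
parities is the RANK of a line: a linear clause `C = ⋁ᵢ (fᵢ = aᵢ)` is the negation of the linear
system `¬C = ⋀ᵢ (fᵢ = aᵢ + 1)` over `𝔽₂`, and `rk(¬C)` — the rank of its coefficient matrix, i.e.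
the dimension of the span `⟨L(C)⟩` of the set `L(C) = {fᵢ}` of linear forms of `C` — is the
quantity bounded from below in the rank / width lower bounds for Res(⊕) (Efremenko–Garlík–Itsykson
2024, Thm 5.5: every Res(⊕) refutation of `BPHPᵐₙ` contains a linear clause `C` with
`rk(¬C) ≥ n/4`; Garlík–Kołodziejczyk 2018 and Itsykson–Sokolov 2020 §2 for linear systems and
their rank). It is BASIS-FREE (a property of the span), unlike the number of disjuncts `|C|`
("principal width", Part–Tzameret 2021), which it never exceeds (`linClauseRank_le_card`).

* `linFormVec f` — the linear form `⊕_{i ∈ f} xᵢ` (`f : Finset ℕ`) as its coefficient vector in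
  `ℕ → ZMod 2`;
* `LinClause.forms C` — the set `L(C)` of coefficient vectors of the linear forms of `C`;
* `linClauseRank C := dim ⟨L(C)⟩` (`Set.finrank`), the rank of the (homogeneous part of the)
  system `¬C`;
* `resLinWidth π` — the width (maximal line rank) of a derivation `π : List ResLinLine`;
* `minResLinWidth φ : ℕ∞` — the least width of a Res(⊕) refutation of `φ` (`⊤` iff none exists).

## Mathlib search

`Module.finrank`, `Submodule.span`, `Set.finrank`, `finrank_range_le_card` (Mathlib
`LinearAlgebra.Dimension.Constructions`) give the rank of a finite family of vectors; nothing on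
linear clauses. Vectors are plain functions `ℕ → ZMod 2` (the forms have finite support, but no
`Finsupp` structure is needed to take spans and dimensions).

## Design notes

* For an INCONSISTENT system `¬C` (a tautological clause `C`, e.g. one containing `0 = 0` or both
  `f = 0` and `f = 1`) `linClauseRank C` is still the dimension of `⟨L(C)⟩`; such lines are never
  needed in a refutation and the lower-bound statements quantify over all lines anyway.
* The constant form `f = ∅` has the zero vector and contributes nothing to the rank.
* For an ordinary clause read as a linear clause (`Clause.toLinClause`) the forms are unit vectors,
  so the rank is the number of distinct variables of the clause (at most its length).
* `resLinWidth` is a plain maximum over ALL lines of the list (no validity is assumed), like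
  `resLinDepth`; `minResLinWidth` minimises over refutations exactly as `minResLinRefutationSize`.

## References

* K. Efremenko, M. Garlík, D. Itsykson, *Lower bounds for regular resolution over parities*,
  STOC 2024 (SIAM J. Comput. 54 (2025)), §2.1–2.2 (linear systems, `L(C)`, Res(⊕)), §1.2 and
  Thm 5.5 (`rk(¬C)`, rank lower bound).
* D. Itsykson, D. Sokolov, *Resolution over linear equations modulo two*, Ann. Pure Appl. Logic
  171 (2020), §2.
* E. Ben-Sasson, A. Wigderson, *Short proofs are narrow — resolution made simple*, J. ACM 48
  (2001), §3 (width of a resolution derivation: the model notion).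
-/

namespace Literature.Computability.MetaComplexity

open _root_.Computability Complexity

/-! ### Linear forms as vectors, the rank of a linear clause -/

/-- The coefficient vector in `𝔽₂^ℕ` of the linear form `⊕_{i ∈ f} xᵢ` with support
`f : Finset ℕ`: `1` on `f`, `0` elsewhere. [Efremenko–Garlík–Itsykson 2024, §2.1 (linear forms
over `𝔽₂`)] [cite: EfremenkoGarlikItsykson2024, §2.1] -/
def linFormVec (f : Finset ℕ) : ℕ → ZMod 2 :=
  fun i => if i ∈ f then 1 else 0

/-- Membership form of `linFormVec`. [folklore] -/
@[simp] theorem linFormVec_apply (f : Finset ℕ) (i : ℕ) :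
    linFormVec f i = if i ∈ f then 1 else 0 := rfl

/-- The zero form: `linFormVec ∅ = 0`. [folklore] -/
@[simp] theorem linFormVec_empty : linFormVec ∅ = 0 := by
  funext i; simp [linFormVec]

/-- `linFormVec` is injective: a form is determined by its coefficient vector. [folklore] -/
theorem linFormVec_injective : Function.Injective linFormVec := by
  intro f g h
  ext i
  have := congrFun h i
  by_cases hf : i ∈ f <;> by_cases hg : i ∈ g <;> simp_all [linFormVec]

/-- The set `L(C)` of (coefficient vectors of) the linear forms occurring in the linear clause `C`.
[Efremenko–Garlík–Itsykson 2024, §2.2 (`L(C)`)] [cite: EfremenkoGarlikItsykson2024, §2.2] -/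
def LinClause.forms (C : LinClause) : Set (ℕ → ZMod 2) :=
  Set.range fun l : C => linFormVec l.1.1

/-- Membership in `L(C)`. [folklore] -/
theorem LinClause.mem_forms_iff {C : LinClause} {v : ℕ → ZMod 2} :
    v ∈ LinClause.forms C ↔ ∃ l ∈ C, linFormVec l.1 = v := by
  constructor
  · rintro ⟨⟨l, hl⟩, rfl⟩
    exact ⟨l, hl, rfl⟩
  · rintro ⟨l, hl, rfl⟩
    exact ⟨⟨l, hl⟩, rfl⟩

/-- `L(∅) = ∅`. [folklore] -/
@[simp] theorem LinClause.forms_empty : LinClause.forms (∅ : LinClause) = ∅ := by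
  ext v
  simp [LinClause.mem_forms_iff]

/-- `L` is monotone. [folklore] -/
theorem LinClause.forms_mono {C D : LinClause} (h : C ⊆ D) :
    LinClause.forms C ⊆ LinClause.forms D := by
  intro v hv
  obtain ⟨l, hl, rfl⟩ := LinClause.mem_forms_iff.1 hv
  exact LinClause.mem_forms_iff.2 ⟨l, h hl, rfl⟩

/-- **The rank of a linear clause** `C = ⋁ᵢ (fᵢ = aᵢ)`: the dimension over `𝔽₂` of the span of
its linear forms `L(C)`, i.e. the rank `rk(¬C)` of the coefficient matrix of the linear system
`¬C = ⋀ᵢ (fᵢ = aᵢ + 1)` — the basis-free "width" of a Res(⊕) line.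
[Efremenko–Garlík–Itsykson 2024, §1.2 and Thm 5.5 (`rk(¬C)`); Itsykson–Sokolov 2020, §2]
[cite: EfremenkoGarlikItsykson2024, Thm 5.5] -/
noncomputable def linClauseRank (C : LinClause) : ℕ :=
  (LinClause.forms C).finrank (ZMod 2)

/-- Unfolding: the rank is the `finrank` of the span of `L(C)`. [folklore] -/
theorem linClauseRank_eq (C : LinClause) :
    linClauseRank C = Module.finrank (ZMod 2) (Submodule.span (ZMod 2) (LinClause.forms C)) := rfl

/-- The empty clause has rank `0`. [folklore] -/
@[simp] theorem linClauseRank_empty : linClauseRank (∅ : LinClause) = 0 := by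
  rw [linClauseRank_eq, LinClause.forms_empty, Submodule.span_empty]
  exact finrank_bot (ZMod 2) (ℕ → ZMod 2)

/-- The rank never exceeds the number of disjuncts (principal width). [folklore] -/
theorem linClauseRank_le_card (C : LinClause) : linClauseRank C ≤ C.card := by
  have h := finrank_range_le_card (R := ZMod 2) (fun l : C => linFormVec l.1.1)
  simpa [linClauseRank, LinClause.forms] using h

/-- The rank is monotone under inclusion of clauses. [folklore] -/
theorem linClauseRank_mono {C D : LinClause} (h : C ⊆ D) : linClauseRank C ≤ linClauseRank D := by
  rw [linClauseRank_eq, linClauseRank_eq]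
  haveI : Module.Finite (ZMod 2) (Submodule.span (ZMod 2) (LinClause.forms D)) := by
    have hfin : (LinClause.forms D).Finite := Set.finite_range _
    exact Module.Finite.span_of_finite (ZMod 2) hfin
  exact Submodule.finrank_mono (Submodule.span_mono (LinClause.forms_mono h))

/-! ### Width of a derivation, minimal refutation width -/

/-- **The width (rank) of a Res(⊕) derivation**: the maximum of `linClauseRank` over its lines
(`0` for the empty list). The Res(⊕) analogue of the width of a resolution derivation.
[Efremenko–Garlík–Itsykson 2024, §1.2 (width/rank of refutations); Ben-Sasson–Wigderson 2001, §3]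
[cite: EfremenkoGarlikItsykson2024, §1.2] -/
noncomputable def resLinWidth (π : List ResLinLine) : ℕ :=
  (π.map fun l => linClauseRank l.clause).foldr max 0

/-- `l.foldr max 0 ≤ n` iff every entry is `≤ n` (helper). [folklore] -/
private theorem foldr_max_zero_le_iff' (l : List ℕ) (n : ℕ) :
    l.foldr max 0 ≤ n ↔ ∀ x ∈ l, x ≤ n := by
  induction l with
  | nil => simp
  | cons a l ih => simp [ih]

/-- The width is `≤ w` iff every line has rank `≤ w`. [folklore] -/
theorem resLinWidth_le_iff {π : List ResLinLine} {w : ℕ} :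
    resLinWidth π ≤ w ↔ ∀ l ∈ π, linClauseRank l.clause ≤ w := by
  rw [resLinWidth, foldr_max_zero_le_iff']
  simp

/-- Every line's rank is at most the width. [folklore] -/
theorem linClauseRank_le_resLinWidth {π : List ResLinLine} {l : ResLinLine} (hl : l ∈ π) :
    linClauseRank l.clause ≤ resLinWidth π :=
  (resLinWidth_le_iff.1 le_rfl) l hl

/-- `w < resLinWidth π` iff some line has rank `> w`. [folklore] -/
theorem lt_resLinWidth_iff {π : List ResLinLine} {w : ℕ} :
    w < resLinWidth π ↔ ∃ l ∈ π, w < linClauseRank l.clause := by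
  rw [← not_iff_not]
  push Not
  exact resLinWidth_le_iff

/-- The width of the empty derivation is `0`. [folklore] -/
@[simp] theorem resLinWidth_nil : resLinWidth [] = 0 := rfl

/-- **The minimal width of a Res(⊕) refutation** of `φ`, in `ℕ∞` (`⊤` iff `φ` has no
refutation). [Efremenko–Garlík–Itsykson 2024, §1.2; Ben-Sasson–Wigderson 2001, §3 (`w(F ⊢ 0)`)]
[cite: EfremenkoGarlikItsykson2024, §1.2] -/
noncomputable def minResLinWidth (φ : CNF ℕ) : ℕ∞ :=
  ⨅ (π : List ResLinLine) (_ : IsResLinRefutation φ π), (resLinWidth π : ℕ∞)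

/-- A refutation bounds the minimal refutation width. [folklore] -/
theorem minResLinWidth_le {φ : CNF ℕ} {π : List ResLinLine} (h : IsResLinRefutation φ π) :
    minResLinWidth φ ≤ resLinWidth π :=
  iInf₂_le π h

/-- `w ≤ minResLinWidth φ` iff every refutation has width `≥ w`. [folklore] -/
theorem le_minResLinWidth_iff {φ : CNF ℕ} {w : ℕ} :
    (w : ℕ∞) ≤ minResLinWidth φ ↔ ∀ π, IsResLinRefutation φ π → w ≤ resLinWidth π := by
  simp [minResLinWidth, le_iInf_iff]

end Literature.Computability.MetaComplexity
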